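import Mathlib.FieldTheory.Finite.Extension
import Mathlib.FieldTheory.PrimitiveElement
import Mathlib.RingTheory.Valuation.LocalSubring
import Mathlib.RingTheory.Polynomial.GaussLemma
import Mathlib.RingTheory.AdjoinRoot
import Mathlib.RingTheory.AlgebraicIndependent.TranscendenceBasis
import Literature.NumberTheory.DiophantineGeometry.FunctionFieldSchmidtDegreeOne
import Literature.NumberTheory.DiophantineGeometry.FunctionFieldSchmidtDegreeOneExtensionProofs
import HarnessLib

/-!
# Constant field extensions `F·𝔽_{q^d} = F[X]/(φ)` of a function field over a finite field, the
splitting of places in them (Stichtenoth §3.6, Lemma 5.1.9), and a zeta-free proof of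
F. K. Schmidt's theorem `∂ = 1` (Cor. 5.1.11)

Library file continuing `FunctionFieldDivisors` / `FunctionFieldGenus` / `FunctionFieldDivisorClasses`
(places `PlaceOver K F`, divisors, degrees, `A_n = numPosDivisors`, `∂ = minPosDegree`). The tree
proves F. K. Schmidt's theorem in `FunctionFieldSchmidtDegreeOneProofs` (`minPosDegree_eq_one_holds`,
Kummer route, treating `F(α)` as a function field over `𝔽_q`); this file develops the constant
field extension *as a function field over the bigger finite field* `𝔽_{q^d}` together with the
transport of places between `F` and a finite extension `F'`, which is the part of Stichtenoth
§§3.1, 3.5, 3.6 and Lemma 5.1.9 that the Hasse–Weil theorem (Thm. 5.2.1, named fact `hasseWeil`,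
whose printed proof runs in the constant field extensions `F_r = F𝔽_{q^r}`) will need, and ends
with a second, zeta-free proof of Cor. 5.1.11 (`false_of_two_le_minPosDegree`), independent of
Kummer's theorem.

## Contents

* **A (the extension `F' = F[X]/(φ)`, `section ConstantExtension`).** For `φ ∈ K[X]` irreducible
  and `K` integrally closed in `F`, `φ` stays irreducible over `F` (**Lemma 3.6.2**,
  `irreducible_map_of_irreducible`, the non-monic form of the tree's
  `irreducible_map_of_isIntegrallyClosedIn`), so `F' := AdjoinRoot (φ.map (algebraMap K F))` is a
  field (instance `fact_irreducible_map` feeding Mathlib's `AdjoinRoot.instField`), finite of degree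
  `deg φ` over `F` (`finrank_adjoinRoot_map`), and an algebra over the finite field
  `K' := AdjoinRoot φ` (`#K' = #K ^ deg φ`) through `AdjoinRoot.lift` (`algebra_adjoinRoot_map`,
  scalar tower `K → K' → F'`). `F'/K'` is an algebraic function field of one variable
  (`isAlgFunctionField_adjoinRoot_map`, transcendence degree by Mathlib's `lift_trdeg_add_eq`) whose
  full constant field is `K'` (**Prop. 3.6.1 (a)**, `isIntegrallyClosedIn_adjoinRoot_map`, printed
  proof via primitive elements and Lemma 3.6.2), so all of `FunctionFieldDivisors` …
  `FunctionFieldDivisorClasses` applies to `F'/K'`. The Frobenius `σ ∈ Gal(F'/F)`, `σ(α) = α^q`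
  (**Lemma 5.1.9 (a)**, `frob`, by `AdjoinRoot.liftAlgHom`); `α^{q^k} ≠ α` for `0 < k < deg φ`
  (`root_map_pow_ne`, order of the Frobenius of `K'`, Mathlib `FiniteField.orderOf_frobeniusAlgHom`).
* **B (places in a finite extension `F'/F` with constant fields `K ⊆ K'`, `section Extension`).**
  `PlaceOver.restrict` — `O_{P'} ∩ F` is a place of `F` (**Def. 3.1.3, Prop. 3.1.7 (a)**);
  `exists_restrict_eq` — every place of `F` has a place of `F'` above it (**Prop. 3.1.7 (b)**, by
  Chevalley's extension theorem, Mathlib `IsLocalRing.exists_factor_valuationRing`);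
  `comapRingEquiv` — transport of places along automorphisms (**Lemma 3.5.2**);
  `exists_valuation_sub_algebraMap_lt_one` — if `[F' : F]` pairwise distinct places lie over `P`,
  each has residue degree one over `P` (**Thm. 3.1.11**, the inequality `∑ fᵢ ≤ [F' : F]`, in the
  form needed, by weak approximation in `F'`); `resHom`, `degree_mul_finrank_eq_degree` — then
  `deg P' · [K' : K] = deg P` (comparing `#F_P` and `#F'_{P'}`);
  `exists_valuation_algebraMap_sub_lt_one` — if `#K' = q^d` and `d ∣ deg P`, residues of constants
  at a place above `P` lie in `F_P` (counting roots of `X^{q^{deg P}} - X`).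
* **B7 (`section Assembly`), Lemma 5.1.9 (d) in the totally split case `deg φ ∣ deg P`.** The
  conjugates `conjPlace φ i P = σ^{-i} P'` (`i < deg φ`) of a chosen place `P' = placeAbove φ P`
  above `P` are pairwise distinct (`conjPlace_injective_left`: `σ^{-k} P' = P'` would give
  `v(α^{q^k} - α) < 1` for the nonzero constant `α^{q^k} - α`) and each has
  `deg (σ^{-i} P') · deg φ = deg P` over `K'` (`degree_conjPlace_mul`).
* **C (`section Counting`), a zeta-free proof of Cor. 5.1.11.** If `∂ = deg φ ≥ 2`, pushing pairs of
  positive divisors of `F` forward along two conjugate sections (`pushDiv`) gives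
  `∑ⱼ A_{(g+j)∂} A_{(n-g-j)∂} ≤ A'_n` (`sum_numPosDivisors_mul_le`); with Lemma 5.1.4 (c) for `F`
  (`pow_le_numPosDivisors`: `A_k ≥ q^{k-g}`) and Lemma 5.1.4 for `F'/K'` (`numPosDivisors_le`:
  `A'_n ≤ h' (q^∂)^{n+1}`) this is `(n - 2g + 1) q^{n∂-2g} ≤ h' q^{∂(n+1)}`, false for
  `n = h' q^{∂+2g} + 2g + 2g'` (`false_of_two_le_minPosDegree`). The printed proof compares instead
  the pole orders at `t = 1` of `Z_{F_∂}(t^∂) = Z(t)^∂` (Prop. 5.1.10). The discharge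
  `minPosDegree_eq_one_holds` itself is the tree's (`FunctionFieldSchmidtDegreeOneProofs`); its
  consequences are in `FunctionFieldSchmidtDegreeOneConsequencesProofs`.

## Design notes

* No named facts: everything is proved (D-0026); the new `def`s (`PlaceOver.restrict`,
  `comapRingEquiv`, `resHom`, `placeAbove`, `conjPlace`, `pushDiv`, `frobHom`, `frob`) are real.
  The instances of `section ConstantExtension` have heads involving the project class
  `IsAlgFunctionField` or the specific `AdjoinRoot` types built from a `Fact (Irreducible φ)`, so
  they cannot clash with Mathlib instances.
* Deliberately NOT here: the conorm, `e(P'|P)`, the general fundamental equality, genus invariance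
  under constant extensions (Thm. 3.6.3 (b)), the splitting into `gcd(deg P, r)` places when
  `r ∤ deg P`, and the zeta identity `Z_{F_r}(t^r) = ∏ Z(ζt)` (Prop. 5.1.10).

## References

* H. Stichtenoth, *Algebraic Function Fields and Codes*, 2nd ed., GTM 254, Springer 2009: Prop. 1.1.5,
  Def. 3.1.3, Prop. 3.1.7, Thm. 3.1.11, Lemma 3.5.2, Prop. 3.6.1, Lemma 3.6.2, Thm. 3.6.3,
  Lemma 5.1.4, Lemma 5.1.9, Prop. 5.1.10, Cor. 5.1.11 (held copy
  `book:stichtenothnd-algebraic-function-fields-codes`, pp. 66–70, 92, 102–104, 161–164 of the text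
  layer). [Stichtenoth2009]
* F. K. Schmidt, *Analytische Zahlentheorie in Körpern der Charakteristik p*, Math. Z. 33 (1931),
  1–32. [Schmidt1931]
-/

noncomputable section

open scoped Classical Polynomial

open Polynomial

namespace Literature.NumberTheory.DiophantineGeometry.AlgFunctionField

universe u v

/-! ### A2. Irreducibility over `F` of polynomials irreducible over the full constant field -/

section IrreducibleMap

variable {K : Type u} {F : Type v} [Field K] [Field F] [Algebra K F]

/-- **Irreducible polynomials over the full constant field stay irreducible over the function
field** (Stichtenoth Lemma 3.6.2), for a not necessarily monic irreducible `φ ∈ K[X]` (the form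
needed to feed `AdjoinRoot.instField` from a `Fact (Irreducible φ)`): reduction by the unit
`C (lead φ)` to the monic case, which is the tree's `irreducible_map_of_isIntegrallyClosedIn`
(`FunctionFieldSchmidtDegreeOneExtensionProofs`). [cite: Stichtenoth2009, Lemma 3.6.2] -/
theorem irreducible_map_of_irreducible [IsIntegrallyClosedIn K F] {φ : K[X]}
    (hφ : Irreducible φ) : Irreducible (φ.map (algebraMap K F)) := by
  have hφ0 : φ ≠ 0 := hφ.ne_zero
  set ψ : K[X] := φ * C (φ.leadingCoeff)⁻¹ with hψ
  have hψm : ψ.Monic := monic_mul_leadingCoeff_inv hφ0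
  have hψirr : Irreducible ψ :=
    (irreducible_mul_isUnit (isUnit_C.mpr (inv_ne_zero (leadingCoeff_ne_zero.mpr hφ0)).isUnit)).mpr
      hφ
  have hφψ : φ.map (algebraMap K F) = ψ.map (algebraMap K F) * C (algebraMap K F φ.leadingCoeff) := by
    rw [hψ, Polynomial.map_mul, map_C, mul_assoc, ← C_mul, map_inv₀,
      inv_mul_cancel₀ ((map_ne_zero_iff _ (algebraMap K F).injective).mpr
        (leadingCoeff_ne_zero.mpr hφ0)), C_1, mul_one]
  rw [hφψ, irreducible_mul_isUnit (isUnit_C.mpr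
    (((map_ne_zero_iff _ (algebraMap K F).injective).mpr (leadingCoeff_ne_zero.mpr hφ0)).isUnit))]
  exact irreducible_map_of_isIntegrallyClosedIn hψirr hψm

end IrreducibleMap

/-! ### A3. The constant field extension `F' = F[X]/(φ)` and `K' = K[X]/(φ)` -/

section ConstantExtension

variable {K : Type u} {F : Type v} [Field K] [Field F] [Algebra K F]
variable (φ : K[X]) [hirr : Fact (Irreducible φ)]

/-- For `φ ∈ K[X]` irreducible and `K` integrally closed in `F`, `φ` is irreducible over `F`
(instance form of `irreducible_map_of_irreducible`, feeding `AdjoinRoot.instField`).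
[cite: Stichtenoth2009, Lemma 3.6.2] -/
instance fact_irreducible_map [IsIntegrallyClosedIn K F] :
    Fact (Irreducible (φ.map (algebraMap K F))) :=
  ⟨irreducible_map_of_irreducible hirr.out⟩

/-- `K' = K[X]/(φ)` is a finite-dimensional `K`-space. [folklore] -/
instance moduleFinite_adjoinRoot : Module.Finite K (AdjoinRoot φ) :=
  Module.Finite.of_basis (AdjoinRoot.powerBasis hirr.out.ne_zero).basis

/-- The finite field `K' = K[X]/(φ)` is finite. [folklore] -/
instance finite_adjoinRoot [Finite K] : Finite (AdjoinRoot φ) :=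
  Module.finite_of_finite K

/-- `[K' : K] = deg φ`. [folklore] -/
theorem finrank_adjoinRoot : Module.finrank K (AdjoinRoot φ) = φ.natDegree := by
  rw [(AdjoinRoot.powerBasis hirr.out.ne_zero).finrank, AdjoinRoot.powerBasis_dim]

/-- `#K' = #K ^ deg φ`. [folklore] -/
theorem natCard_adjoinRoot [Finite K] : Nat.card (AdjoinRoot φ) = Nat.card K ^ φ.natDegree := by
  rw [Module.natCard_eq_pow_finrank (K := K), finrank_adjoinRoot]

variable [IsIntegrallyClosedIn K F]

/-- `φ` has the root `X mod φ` of `F' = F[X]/(φ)` (evaluated through `K → F'`). [folklore] -/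
theorem eval₂_root_map :
    φ.eval₂ (algebraMap K (AdjoinRoot (φ.map (algebraMap K F))))
      (AdjoinRoot.root (φ.map (algebraMap K F))) = 0 := by
  rw [IsScalarTower.algebraMap_eq K F (AdjoinRoot (φ.map (algebraMap K F))), ← eval₂_map,
    AdjoinRoot.algebraMap_eq]
  exact AdjoinRoot.eval₂_root _

/-- The structure map `K' = K[X]/(φ) → F' = F[X]/(φ)`, `X mod φ ↦ X mod φ`. [folklore] -/
instance algebra_adjoinRoot_map :
    Algebra (AdjoinRoot φ) (AdjoinRoot (φ.map (algebraMap K F))) :=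
  (AdjoinRoot.lift (algebraMap K _) (AdjoinRoot.root (φ.map (algebraMap K F)))
    (eval₂_root_map φ)).toAlgebra

/-- Unfolding of the structure map `K' → F'` (definitional). [folklore] -/
theorem algebraMap_adjoinRoot_def :
    algebraMap (AdjoinRoot φ) (AdjoinRoot (φ.map (algebraMap K F))) =
      AdjoinRoot.lift (algebraMap K _) (AdjoinRoot.root (φ.map (algebraMap K F)))
        (eval₂_root_map φ) :=
  rfl

/-- `K → K' → F'` is a scalar tower. [folklore] -/
instance isScalarTower_adjoinRoot_map :
    IsScalarTower K (AdjoinRoot φ) (AdjoinRoot (φ.map (algebraMap K F))) :=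
  IsScalarTower.of_algebraMap_eq fun c => by
    change _ = AdjoinRoot.lift _ _ (eval₂_root_map φ) (algebraMap K (AdjoinRoot φ) c)
    rw [AdjoinRoot.algebraMap_eq, AdjoinRoot.lift_of]

/-- The structure map sends `X mod φ ∈ K'` to `X mod φ ∈ F'`. [folklore] -/
theorem algebraMap_root :
    algebraMap (AdjoinRoot φ) (AdjoinRoot (φ.map (algebraMap K F))) (AdjoinRoot.root φ) =
      AdjoinRoot.root (φ.map (algebraMap K F)) := by
  rw [algebraMap_adjoinRoot_def, AdjoinRoot.lift_root]

/-- `[F' : F] = deg φ`. [folklore] -/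
theorem finrank_adjoinRoot_map :
    Module.finrank F (AdjoinRoot (φ.map (algebraMap K F))) = φ.natDegree := by
  rw [finrank_adjoinRoot, natDegree_map]

/-- `F'/F` is finite-dimensional. [folklore] -/
instance finiteDimensional_adjoinRoot_map :
    FiniteDimensional F (AdjoinRoot (φ.map (algebraMap K F))) :=
  Module.Finite.of_basis (AdjoinRoot.powerBasis (fact_irreducible_map φ).out.ne_zero).basis

/-- `φ(α) = 0` for `α = X mod φ ∈ F'`, as a `K`-algebra evaluation. [folklore] -/
theorem aeval_root_map : aeval (AdjoinRoot.root (φ.map (algebraMap K F))) φ = 0 := by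
  rw [aeval_def]
  exact eval₂_root_map φ


/-! ### A5. `F'/K'` is an algebraic function field of one variable -/

/-- The transcendence degree of `F' = F[X]/(φ)` over `K` is `1` (`F'/F` is finite). [folklore] -/
theorem trdeg_adjoinRoot_map_eq_one [IsAlgFunctionField K F] :
    Algebra.trdeg K (AdjoinRoot (φ.map (algebraMap K F))) = 1 := by
  have h := trdeg_add_eq K F (A := AdjoinRoot (φ.map (algebraMap K F)))
  rw [IsAlgFunctionField.trdeg_eq_one (K := K) (F := F),
    trdeg_eq_zero (R := F) (A := AdjoinRoot (φ.map (algebraMap K F))), add_zero] at h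
  exact h.symm

/-- The transcendence degree of `F' = F[X]/(φ)` over `K' = K[X]/(φ)` is `1`. [folklore] -/
theorem trdeg_adjoinRoot_adjoinRoot_map_eq_one [Finite K] [IsAlgFunctionField K F] :
    Algebra.trdeg (AdjoinRoot φ) (AdjoinRoot (φ.map (algebraMap K F))) = 1 := by
  have h := lift_trdeg_add_eq K (AdjoinRoot φ) (AdjoinRoot (φ.map (algebraMap K F)))
  rw [trdeg_eq_zero (R := K) (A := AdjoinRoot φ), trdeg_adjoinRoot_map_eq_one] at h
  simpa using h

/-- Every element of `F` lies in the subfield of `F'` generated over `K'` by the image of a set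
of generators of `F/K`. [folklore] -/
theorem algebraMap_mem_adjoin_image {S : Set F} (hS : IntermediateField.adjoin K S = ⊤) (y : F) :
    algebraMap F (AdjoinRoot (φ.map (algebraMap K F))) y ∈
      IntermediateField.adjoin (AdjoinRoot φ)
        (algebraMap F (AdjoinRoot (φ.map (algebraMap K F))) '' S) := by
  set L := IntermediateField.adjoin (AdjoinRoot φ)
    (algebraMap F (AdjoinRoot (φ.map (algebraMap K F))) '' S) with hL
  set f : F →ₐ[K] AdjoinRoot (φ.map (algebraMap K F)) :=
    IsScalarTower.toAlgHom K F (AdjoinRoot (φ.map (algebraMap K F))) with hf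
  have hfS : f '' S = algebraMap F (AdjoinRoot (φ.map (algebraMap K F))) '' S := by
    refine Set.image_congr fun z _ => ?_
    rfl
  have h2 : IntermediateField.adjoin K (f '' S) ≤ L.restrictScalars K := by
    rw [IntermediateField.adjoin_le_iff, hfS]
    exact IntermediateField.subset_adjoin (AdjoinRoot φ) _
  have hy : y ∈ IntermediateField.adjoin K S := by
    rw [hS]
    exact IntermediateField.mem_top
  have h1 : f y ∈ (IntermediateField.adjoin K S).map f := by
    rw [← SetLike.mem_coe, IntermediateField.coe_map]
    exact ⟨y, hy, rfl⟩
  rw [IntermediateField.adjoin_map] at h1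
  have h3 : f y ∈ L.restrictScalars K := h2 h1
  exact (IntermediateField.mem_restrictScalars K).mp h3

/-- `F'` is finitely generated over `K'` (by the images of generators of `F/K`; the class of `X`
is already in `K'`). [folklore] -/
theorem fg_top_adjoinRoot_map [IsAlgFunctionField K F] :
    (⊤ : IntermediateField (AdjoinRoot φ) (AdjoinRoot (φ.map (algebraMap K F)))).FG := by
  obtain ⟨S, hS⟩ := IsAlgFunctionField.fg_top (K := K) (F := F)
  refine ⟨S.image (algebraMap F _), ?_⟩
  rw [Finset.coe_image, eq_top_iff]
  intro x _
  induction x using AdjoinRoot.induction_on with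
  | ih p =>
    rw [← AdjoinRoot.aeval_eq, aeval_eq_sum_range]
    refine sum_mem fun i _ => ?_
    rw [Algebra.smul_def]
    refine mul_mem (algebraMap_mem_adjoin_image φ hS _) (pow_mem ?_ _)
    rw [← algebraMap_root φ]
    exact IntermediateField.algebraMap_mem _ _

/-- **Stichtenoth Prop. 3.6.1 (shape of a constant field extension)**: `F' = F[X]/(φ)` is an
algebraic function field of one variable over `K' = K[X]/(φ)`. [cite: Stichtenoth2009, Prop. 3.6.1] -/
instance isAlgFunctionField_adjoinRoot_map [Finite K] [IsAlgFunctionField K F] :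
    IsAlgFunctionField (AdjoinRoot φ) (AdjoinRoot (φ.map (algebraMap K F))) where
  trdeg_eq_one := trdeg_adjoinRoot_adjoinRoot_map_eq_one φ
  fg_top := fg_top_adjoinRoot_map φ

/-! ### A6. `K'` is the full constant field of `F'` -/

/-- `α = X mod φ ∈ F'` is integral over `K`. [folklore] -/
theorem isIntegral_root_map [Finite K] :
    IsIntegral K (AdjoinRoot.root (φ.map (algebraMap K F))) := by
  rw [← algebraMap_root φ]
  exact (Algebra.IsIntegral.isIntegral (R := K) (AdjoinRoot.root φ)).algebraMap

/-- `[K(α) : K] = deg φ` inside `F'`. [folklore] -/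
theorem finrank_adjoin_root_map [Finite K] :
    Module.finrank K (IntermediateField.adjoin K
      {AdjoinRoot.root (φ.map (algebraMap K F))}) = φ.natDegree := by
  rw [IntermediateField.adjoin.finrank (isIntegral_root_map φ),
    ← minpoly.eq_of_irreducible hirr.out (aeval_root_map φ), natDegree_mul_C]
  exact inv_ne_zero (leadingCoeff_ne_zero.mpr hirr.out.ne_zero)

/-- For `γ ∈ F'` algebraic over `K`, `[F(γ) : F] = [K(γ) : K]` (the minimal polynomial over `K`
stays irreducible over `F`, Stichtenoth Lemma 3.6.2).
[cite: Stichtenoth2009, Lemma 3.6.2] -/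
theorem finrank_adjoin_eq_of_isIntegral {γ : AdjoinRoot (φ.map (algebraMap K F))}
    (hγ : IsIntegral K γ) :
    Module.finrank F (IntermediateField.adjoin F {γ}) =
      Module.finrank K (IntermediateField.adjoin K {γ}) := by
  have hγF : IsIntegral F γ := .of_finite F γ
  rw [IntermediateField.adjoin.finrank hγ, IntermediateField.adjoin.finrank hγF,
    ← minpoly.eq_of_irreducible_of_monic (irreducible_map_of_irreducible
      (minpoly.irreducible hγ)) _ ((minpoly.monic hγ).map _), natDegree_map]
  rw [aeval_map_algebraMap, minpoly.aeval]

/-- **Stichtenoth Prop. 3.6.1 (a) / Lemma 5.1.9 (b)**: `K' = K[X]/(φ)` is the full constant field of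
the constant field extension `F' = F[X]/(φ)`: every element of `F'` algebraic over `K'` lies in
`K'`. Proof: for `x` algebraic, `K(α, x) = K(γ)` is a finite field; `[F(γ) : F] = [K(γ) : K]`
(Lemma 3.6.2) is at most `[F' : F] = deg φ = [K(α) : K]`, so `K(α, x) = K(α)` (this is the printed
proof of Prop. 3.6.1 (a), with `K` finite hence perfect). [cite: Stichtenoth2009, Prop. 3.6.1(a)] -/
instance isIntegrallyClosedIn_adjoinRoot_map [Finite K] :
    IsIntegrallyClosedIn (AdjoinRoot φ) (AdjoinRoot (φ.map (algebraMap K F))) := by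
  refine isIntegrallyClosedIn_iff.mpr
    ⟨(algebraMap (AdjoinRoot φ) (AdjoinRoot (φ.map (algebraMap K F)))).injective,
      fun {x} hx => ?_⟩
  set α : AdjoinRoot (φ.map (algebraMap K F)) := AdjoinRoot.root (φ.map (algebraMap K F)) with hα
  have hxK : IsIntegral K x := isIntegral_trans x hx
  have hαK : IsIntegral K α := isIntegral_root_map φ
  set E : IntermediateField K (AdjoinRoot (φ.map (algebraMap K F))) :=
    IntermediateField.adjoin K {α, x} with hE
  haveI : FiniteDimensional K E := by
    refine IntermediateField.finiteDimensional_adjoin fun y hy => ?_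
    rcases hy with rfl | rfl
    exacts [hαK, hxK]
  haveI : Finite E := Module.finite_of_finite K
  obtain ⟨γ, hγ⟩ := Field.exists_primitive_element_of_finite_top K E
  have hγE : IntermediateField.adjoin K {(γ : AdjoinRoot (φ.map (algebraMap K F)))} = E := by
    have := congrArg (IntermediateField.lift (F := E)) hγ
    rwa [IntermediateField.lift_adjoin_simple, IntermediateField.lift_top] at this
  have hγK : IsIntegral K (γ : AdjoinRoot (φ.map (algebraMap K F))) :=
    (IsIntegral.of_finite K γ).algebraMap
  -- `[K(γ) : K] = [F(γ) : F] ≤ [F' : F] = deg φ`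
  have hle : Module.finrank K E ≤ φ.natDegree := by
    rw [← hγE, ← finrank_adjoin_eq_of_isIntegral φ hγK, ← finrank_adjoinRoot_map (F := F) φ]
    exact Submodule.finrank_le
      (IntermediateField.adjoin F {(γ : AdjoinRoot (φ.map (algebraMap K F)))}).toSubalgebra.toSubmodule
  -- `K(α) ≤ E` has the same dimension, hence equality
  have hαE : IntermediateField.adjoin K {α} ≤ E :=
    IntermediateField.adjoin.mono K _ _ (Set.singleton_subset_iff.mpr (Set.mem_insert α {x}))
  have hge : φ.natDegree ≤ Module.finrank K E := by
    rw [← finrank_adjoin_root_map (F := F) φ]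
    exact Submodule.finrank_mono (s := (IntermediateField.adjoin K {α}).toSubalgebra.toSubmodule)
      (t := E.toSubalgebra.toSubmodule) hαE
  have heq : IntermediateField.adjoin K {α} = E :=
    IntermediateField.eq_of_le_of_finrank_eq hαE
      (by rw [finrank_adjoin_root_map]; exact le_antisymm hge hle)
  have hxE : x ∈ E := IntermediateField.subset_adjoin K _ (Set.mem_insert_of_mem α rfl)
  rw [← heq] at hxE
  -- elements of `K(α)` are polynomials in `α`, i.e. images of `K'`
  have hxA : x ∈ (IntermediateField.adjoin K {α}).toSubalgebra := hxE
  rw [IntermediateField.adjoin_simple_toSubalgebra_of_isAlgebraic hαK.isAlgebraic,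
    Algebra.adjoin_singleton_eq_range_aeval] at hxA
  obtain ⟨r, hr⟩ := hxA
  refine ⟨aeval (AdjoinRoot.root φ) r, ?_⟩
  rw [← aeval_algebraMap_apply, algebraMap_root]
  exact hr

/-! ### A7. The Frobenius automorphism of `F'/F` -/

variable [Fintype K]

/-- `φ(α^q) = 0`: the `q`-th power of the root `α` is again a root of `φ ∈ 𝔽_q[X]`. [folklore] -/
theorem eval₂_root_map_pow_card :
    (φ.map (algebraMap K F)).eval₂
      (↑(Algebra.ofId F (AdjoinRoot (φ.map (algebraMap K F)))) : F →+* _)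
      (AdjoinRoot.root (φ.map (algebraMap K F)) ^ Fintype.card K) = 0 := by
  have h1 : (↑(Algebra.ofId F (AdjoinRoot (φ.map (algebraMap K F)))) : F →+* _) =
      algebraMap F (AdjoinRoot (φ.map (algebraMap K F))) := RingHom.ext fun _ => rfl
  rw [h1, eval₂_map, ← IsScalarTower.algebraMap_eq, ← aeval_def, ← expand_aeval,
    FiniteField.expand_card, map_pow, aeval_root_map, zero_pow Fintype.card_ne_zero]

/-- The `F`-algebra endomorphism of `F' = F(α)` with `α ↦ α^q`. [folklore] -/
def frobHom : AdjoinRoot (φ.map (algebraMap K F)) →ₐ[F] AdjoinRoot (φ.map (algebraMap K F)) :=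
  AdjoinRoot.liftAlgHom _ (Algebra.ofId F _) _ (eval₂_root_map_pow_card φ)

/-- `α ↦ α^q` under the Frobenius endomorphism. [folklore] -/
theorem frobHom_root :
    frobHom φ (AdjoinRoot.root (φ.map (algebraMap K F))) =
      AdjoinRoot.root (φ.map (algebraMap K F)) ^ Fintype.card K :=
  AdjoinRoot.liftAlgHom_root _ _ _ _

/-- **Stichtenoth Lemma 5.1.9 (a)** (the Frobenius automorphism): the `F`-automorphism `σ` of the
constant field extension `F' = F(α)` with `σ(α) = α^q`. [cite: Stichtenoth2009, Lemma 5.1.9(a)] -/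
def frob : AdjoinRoot (φ.map (algebraMap K F)) ≃ₐ[F] AdjoinRoot (φ.map (algebraMap K F)) :=
  haveI hinj : Function.Injective (frobHom (F := F) φ) := (frobHom (F := F) φ).toRingHom.injective
  AlgEquiv.ofBijective (frobHom (F := F) φ)
    ⟨hinj, (LinearMap.injective_iff_surjective (f := (frobHom (F := F) φ).toLinearMap)).mp hinj⟩

/-- `σ(α) = α^q`. [cite: Stichtenoth2009, Lemma 5.1.9(a)] -/
theorem frob_root :
    frob φ (AdjoinRoot.root (φ.map (algebraMap K F))) =
      AdjoinRoot.root (φ.map (algebraMap K F)) ^ Fintype.card K :=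
  frobHom_root (F := F) φ

/-- `σ^k(α) = α^(q^k)`. [folklore] -/
theorem frob_pow_root (k : ℕ) :
    (frob φ ^ k) (AdjoinRoot.root (φ.map (algebraMap K F))) =
      AdjoinRoot.root (φ.map (algebraMap K F)) ^ (Fintype.card K ^ k) := by
  induction k with
  | zero => simp
  | succ k ih =>
    rw [pow_succ', AlgEquiv.mul_apply, ih, map_pow, frob_root, ← pow_mul, ← pow_succ']

/-- `α^(q^k) ≠ α` for `0 < k < deg φ`: the Frobenius of the finite field `K' = 𝔽_q(α)` has order
`[K' : 𝔽_q] = deg φ` (Mathlib `FiniteField.orderOf_frobeniusAlgHom`). [folklore] -/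
theorem root_map_pow_ne {k : ℕ} (hk0 : 0 < k) (hk : k < φ.natDegree) :
    AdjoinRoot.root (φ.map (algebraMap K F)) ^ (Fintype.card K ^ k) ≠
      AdjoinRoot.root (φ.map (algebraMap K F)) := by
  intro h
  rw [← algebraMap_root φ, ← map_pow] at h
  have h' := (algebraMap (AdjoinRoot φ) (AdjoinRoot (φ.map (algebraMap K F)))).injective h
  set f := FiniteField.frobeniusAlgHom K (AdjoinRoot φ) with hf
  have hfk : f ^ k = 1 := by
    apply AdjoinRoot.algHom_ext
    rw [AlgHom.coe_pow, hf, FiniteField.coe_frobeniusAlgHom, pow_iterate, AlgHom.one_apply]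
    exact h'
  have hdvd : φ.natDegree ∣ k := by
    rw [← finrank_adjoinRoot φ, ← FiniteField.orderOf_frobeniusAlgHom K (AdjoinRoot φ), ← hf]
    exact orderOf_dvd_of_pow_eq_one hfk
  exact absurd (Nat.le_of_dvd hk0 hdvd) (not_le.mpr hk)

end ConstantExtension


/-! ## B. Places in a finite extension `F'/F` of function fields (`K ⊆ F`, `K' ⊆ F'` the constant
fields; used for the constant field extension `F' = F·𝔽_{q^∂}`) -/

section ValuationLemmas

variable {L : Type*} [Field L]

/-- For `y ≠ 0`: `v(y) < 1` iff `y⁻¹ ∉ O`. [folklore] -/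
theorem valuation_lt_one_iff_inv_notMem (O : ValuationSubring L) {y : L}
    (hy : y ≠ 0) : O.valuation y < 1 ↔ y⁻¹ ∉ O := by
  rw [← O.valuation_le_one_iff, not_le, O.valuation.val_lt_one_iff hy]

/-- Elements of a finite subfield lie in every valuation ring (they are roots of unity or `0`;
Stichtenoth Prop. 1.1.5 (c) for `K = 𝔽_q`). [cite: Stichtenoth2009, Prop. 1.1.5(c)] -/
theorem algebraMap_mem_of_finite {k : Type*} [Field k] [Finite k] [Algebra k L]
    (O : ValuationSubring L) (c : k) : algebraMap k L c ∈ O := by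
  haveI := Fintype.ofFinite k
  by_cases hc : c = 0
  · simp [hc]
  rcases O.mem_or_inv_mem (algebraMap k L c) with h | h
  · exact h
  · have hq : 1 ≤ Fintype.card k - 1 := by
      have := Fintype.one_lt_card_iff_nontrivial.mpr (inferInstance : Nontrivial k)
      omega
    have hc1 : (algebraMap k L c) ^ (Fintype.card k - 1) = 1 := by
      rw [← map_pow, FiniteField.pow_card_sub_one_eq_one c hc, map_one]
    have key : algebraMap k L c = ((algebraMap k L c)⁻¹) ^ (Fintype.card k - 1 - 1) := by
      rw [inv_pow]
      exact eq_inv_of_mul_eq_one_left (by rw [← pow_succ', Nat.sub_add_cancel hq, hc1])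
    rw [key]
    exact pow_mem h _

end ValuationLemmas

section Extension

universe u' v'

variable {K : Type u} {F : Type v} [Field K] [Field F] [Algebra K F]
variable {K' : Type u'} {F' : Type v'} [Field K'] [Field F'] [Algebra K' F']
variable [Algebra F F']

/-- `σ^k(α) = α^(q^k)` for an `F`-automorphism with `σ(α) = α^q`. [folklore] -/
theorem algEquiv_pow_apply_eq_pow {σ : F' ≃ₐ[F] F'} {α : F'} {q : ℕ} (hσα : σ α = α ^ q) (k : ℕ) :
    (σ ^ k) α = α ^ (q ^ k) := by
  induction k with
  | zero => simp
  | succ k ih => rw [pow_succ', AlgEquiv.mul_apply, ih, map_pow, hσα, ← pow_mul, ← pow_succ']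

namespace PlaceOver

/-! ### B1. Restriction of places from `F'` to `F` -/

section Restrict

variable [Algebra K F'] [IsScalarTower K F F'] [Algebra K K'] [IsScalarTower K K' F']

/-- The trace on `F` of a valuation ring `O' ≠ F'` of the finite extension `F'` is a proper subring
of `F`: otherwise `F ⊆ O'` and every element of `F'`, being algebraic over `F`, lies in `O'`
(Stichtenoth Prop. 1.1.5 (c), applied over the constant field `F`). [cite: Stichtenoth2009, Prop. 1.1.5(c)] -/
theorem comap_algebraMap_ne_top [FiniteDimensional F F'] (B : PlaceOver K' F') :
    B.toValuationSubring.comap (algebraMap F F') ≠ ⊤ := by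
  intro h
  apply B.ne_top
  refine top_unique fun y _ => ?_
  have hF : ∀ c : F, algebraMap F F' c ∈ B.toValuationSubring := fun c => by
    have : c ∈ B.toValuationSubring.comap (algebraMap F F') := h ▸ ValuationSubring.mem_top c
    exact this
  exact IsAlgFunctionField.mem_valuationSubring_of_isAlgebraic (K := F) B.toValuationSubring hF
    (Algebra.IsAlgebraic.isAlgebraic y)

omit [Algebra K' F'] in
/-- `K ⊆ O' ∩ F` for a valuation ring `O' ⊇ K'` of `F'`. [folklore] -/
theorem algebraMap_mem_comap_algebraMap [Algebra K' F'] [IsScalarTower K K' F'] (B : PlaceOver K' F')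
    (c : K) : algebraMap K F c ∈ B.toValuationSubring.comap (algebraMap F F') := by
  change algebraMap F F' (algebraMap K F c) ∈ B.toValuationSubring
  rw [← IsScalarTower.algebraMap_apply, IsScalarTower.algebraMap_apply K K' F']
  exact B.algebraMap_mem _

variable [IsAlgFunctionField K F] [FiniteDimensional F F']

/-- **Restriction of places** (Stichtenoth Def. 3.1.3 and Prop. 3.1.7 (a): `P = P' ∩ F` is a place
of `F/K`, the unique place below the place `P'` of a finite extension `F'/K'` of `F/K`): the
valuation ring `O_{P'} ∩ F`. [cite: Stichtenoth2009, Def. 3.1.3 and Prop. 3.1.7(a)] -/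
def restrict (B : PlaceOver K' F') : PlaceOver K F where
  toValuationSubring := B.toValuationSubring.comap (algebraMap F F')
  ne_top := B.comap_algebraMap_ne_top
  isDVR := IsAlgFunctionField.isDiscreteValuationRing_of_ne_top_of_algebraMap_mem (K := K) _
    B.comap_algebraMap_ne_top B.algebraMap_mem_comap_algebraMap
  algebraMap_mem := B.algebraMap_mem_comap_algebraMap

/-- Membership in the restricted place (definitional). [folklore] -/
theorem mem_restrict_iff (B : PlaceOver K' F') (x : F) :
    x ∈ (B.restrict (K := K) (F := F)).toValuationSubring ↔
      algebraMap F F' x ∈ B.toValuationSubring :=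
  Iff.rfl

end Restrict

/-! ### B2. Existence of a place above a given place (Chevalley) -/

section Exists

variable [Algebra K F'] [IsScalarTower K F F'] [Algebra K K'] [IsScalarTower K K' F']
variable [IsAlgFunctionField K F] [FiniteDimensional F F'] [Finite K'] [IsAlgFunctionField K' F']

/-- **Every place of `F` has a place of `F'` above it** (Stichtenoth Prop. 3.1.7 (b)); here via
Chevalley's extension theorem (Mathlib `IsLocalRing.exists_factor_valuationRing`): a valuation
ring `O'` of `F'` dominating `O_P` satisfies `O' ∩ F = O_P` (domination and `x ∉ O_P ⇒ x⁻¹ ∈ m_P`),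
and `O' ≠ F'` since a uniformizer of `P` stays a non-unit. [cite: Stichtenoth2009, Prop. 3.1.7(b)] -/
theorem exists_restrict_eq (P : PlaceOver K F) :
    ∃ B : PlaceOver K' F', B.restrict = P := by
  set f : P.toValuationSubring →+* F' := (algebraMap F F').comp P.toValuationSubring.subtype
    with hf
  obtain ⟨A, hA, hloc⟩ := IsLocalRing.exists_factor_valuationRing f
  -- `A ∩ F ⊆ O_P` (domination)
  have key : ∀ x : F, algebraMap F F' x ∈ A → x ∈ P.toValuationSubring := by
    intro x hx
    by_contra hxP
    have hx0 : x ≠ 0 := by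
      rintro rfl
      exact hxP (zero_mem _)
    have hxinv : x⁻¹ ∈ P.toValuationSubring :=
      (P.toValuationSubring.mem_or_inv_mem x).resolve_left hxP
    have hu : IsUnit (f.codRestrict A.toSubring hA ⟨x⁻¹, hxinv⟩) := by
      refine IsUnit.of_mul_eq_one ⟨algebraMap F F' x, hx⟩ ?_
      apply Subtype.ext
      change algebraMap F F' x⁻¹ * algebraMap F F' x = 1
      rw [map_inv₀, inv_mul_cancel₀ ((_root_.map_ne_zero _).mpr hx0)]
    obtain ⟨u, hu'⟩ := hloc.map_nonunit _ hu
    apply hxP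
    have h1 : ((u⁻¹ : P.toValuationSubringˣ) : F) * x⁻¹ = 1 := by
      have := congrArg (fun z : P.toValuationSubring => (z : F)) u.inv_mul
      rwa [hu'] at this
    rw [mul_inv_eq_one₀ hx0] at h1
    rw [← h1]
    exact SetLike.coe_mem _
  -- `A ≠ F'`
  have hAtop : A ≠ ⊤ := by
    intro hAT
    have hπ := P.irreducible_uniformizer
    apply hπ.not_isUnit
    apply hloc.map_nonunit
    have hπ0 : (P.uniformizer : F) ≠ 0 := fun h => hπ.ne_zero (Subtype.ext h)
    refine IsUnit.of_mul_eq_one ⟨(algebraMap F F' P.uniformizer)⁻¹,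
      hAT ▸ ValuationSubring.mem_top _⟩ ?_
    apply Subtype.ext
    change algebraMap F F' (P.uniformizer : F) * (algebraMap F F' P.uniformizer)⁻¹ = 1
    rw [mul_inv_cancel₀ ((_root_.map_ne_zero _).mpr hπ0)]
  refine ⟨⟨A, hAtop, IsAlgFunctionField.isDiscreteValuationRing_of_ne_top_of_algebraMap_mem
    (K := K') A hAtop (algebraMap_mem_of_finite A), algebraMap_mem_of_finite A⟩, ?_⟩
  apply PlaceOver.ext
  ext x
  exact ⟨key x, fun hx => hA ⟨x, hx⟩⟩

end Exists

/-! ### B3. Transport of places along automorphisms -/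

section Comap

variable [Finite K'] [IsAlgFunctionField K' F']

omit [Algebra F F'] [Finite K'] [IsAlgFunctionField K' F'] in
/-- Transport of a place along a field automorphism `σ` of `F'`: the valuation ring `σ⁻¹(O)`.
[folklore] -/
theorem comap_ringEquiv_ne_top (σ : F' ≃+* F') (B : PlaceOver K' F') :
    B.toValuationSubring.comap (σ : F' →+* F') ≠ ⊤ := by
  intro h
  apply B.ne_top
  refine top_unique fun y _ => ?_
  obtain ⟨x, rfl⟩ := σ.surjective y
  have : x ∈ B.toValuationSubring.comap (σ : F' →+* F') := h ▸ ValuationSubring.mem_top x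
  exact this

omit [Algebra F F'] in
/-- The place `σ⁻¹(P')` (Stichtenoth Lemma 3.5.2: automorphisms permute the places).
[cite: Stichtenoth2009, Lemma 3.5.2] -/
def comapRingEquiv (σ : F' ≃+* F') (B : PlaceOver K' F') : PlaceOver K' F' where
  toValuationSubring := B.toValuationSubring.comap (σ : F' →+* F')
  ne_top := B.comap_ringEquiv_ne_top σ
  isDVR := IsAlgFunctionField.isDiscreteValuationRing_of_ne_top_of_algebraMap_mem (K := K') _
    (B.comap_ringEquiv_ne_top σ) (algebraMap_mem_of_finite _)
  algebraMap_mem := algebraMap_mem_of_finite _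

omit [Algebra F F'] in
/-- Membership in the transported place (definitional). [folklore] -/
theorem mem_comapRingEquiv_iff (σ : F' ≃+* F') (B : PlaceOver K' F') (x : F') :
    x ∈ (B.comapRingEquiv σ).toValuationSubring ↔ σ x ∈ B.toValuationSubring :=
  Iff.rfl

omit [Algebra F F'] in
/-- `(σ τ)⁻¹ P' = τ⁻¹ (σ⁻¹ P')`. [folklore] -/
theorem comapRingEquiv_comapRingEquiv (σ τ : F' ≃+* F') (B : PlaceOver K' F') :
    (B.comapRingEquiv σ).comapRingEquiv τ = B.comapRingEquiv (τ.trans σ) := by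
  apply PlaceOver.ext
  ext x
  rfl

omit [Algebra F F'] in
/-- Transport along a fixed automorphism is injective on places. [folklore] -/
theorem comapRingEquiv_injective (σ : F' ≃+* F') :
    Function.Injective (comapRingEquiv (K' := K') σ) := by
  intro B₁ B₂ h
  apply PlaceOver.ext
  ext y
  obtain ⟨x, rfl⟩ := σ.surjective y
  rw [← mem_comapRingEquiv_iff σ B₁, ← mem_comapRingEquiv_iff σ B₂, h]

omit [Algebra F F'] in
/-- The valuation of the transported place: `v_{σ⁻¹ P'}(x) < 1 ↔ v_{P'}(σ x) < 1`. [folklore] -/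
theorem valuation_comapRingEquiv_lt_one_iff (σ : F' ≃+* F') (B : PlaceOver K' F') (x : F') :
    (B.comapRingEquiv σ).valuation x < 1 ↔ B.valuation (σ x) < 1 := by
  by_cases hx : x = 0
  · simp [hx]
  rw [valuation_lt_one_iff_inv_notMem (B.comapRingEquiv σ).toValuationSubring hx,
    valuation_lt_one_iff_inv_notMem B.toValuationSubring ((map_ne_zero σ).mpr hx),
    mem_comapRingEquiv_iff, map_inv₀]

variable [Algebra K F'] [IsScalarTower K F F'] [Algebra K K'] [IsScalarTower K K' F']
variable [IsAlgFunctionField K F] [FiniteDimensional F F']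

/-- Transport along an `F`-automorphism does not change the place below. [folklore] -/
theorem restrict_comapRingEquiv (σ : F' ≃ₐ[F] F') (B : PlaceOver K' F') :
    (B.comapRingEquiv (σ : F' ≃+* F')).restrict (K := K) (F := F) = B.restrict := by
  apply PlaceOver.ext
  ext x
  change σ (algebraMap F F' x) ∈ B.toValuationSubring ↔ algebraMap F F' x ∈ B.toValuationSubring
  rw [AlgEquiv.commutes]

end Comap

/-! ### B4. The conjugates of a place above `P` under the Frobenius are distinct -/

section Conjugates

variable [Algebra K F'] [Algebra K K'] [IsScalarTower K K' F']
variable [Finite K'] [IsAlgFunctionField K' F']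

/-- **The Frobenius conjugates of a place are pairwise distinct** (the heart of Stichtenoth
Lemma 5.1.9 (d) / Thm. 3.6.3 (g) in the totally split case): let `P'` lie over `P`, let `σ` be an
`F`-automorphism of `F'` with `σ(α) = α^q`, where `α` is algebraic over `K`, `α^(q^k) ≠ α` for
`0 < k < d`, and the residue class of `α` at `P'` comes from `F_P` (`v_{P'}(α - c) < 1` for some
`c ∈ O_P`). Then the places `σ^{-i} P'`, `i < d`, are pairwise distinct: if `σ^{-k} P' = P'` then
`v_{P'}(α^(q^k) - c) < 1`, so `v_{P'}(α^(q^k) - α) < 1`, but `α^(q^k) - α ≠ 0` is algebraic over `K`,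
hence a unit at every place. [cite: Stichtenoth2009, Lemma 5.1.9(d)] -/
theorem comapRingEquiv_pow_injective (P : PlaceOver K F) (A : PlaceOver K' F')
    (σ : F' ≃ₐ[F] F') {α : F'} {q d : ℕ} (hσα : σ α = α ^ q)
    (hne : ∀ k, 0 < k → k < d → α ^ (q ^ k) ≠ α) (halg : IsAlgebraic K α)
    (hαc : ∃ c ∈ P.toValuationSubring, A.valuation (α - algebraMap F F' c) < 1) :
    Function.Injective fun i : Fin d =>
      A.comapRingEquiv ((σ ^ (i : ℕ) : F' ≃ₐ[F] F') : F' ≃+* F') := by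
  -- constants of `F'` algebraic over `K` lie in every place, with their inverses
  have hK : ∀ c : K, algebraMap K F' c ∈ A.toValuationSubring := fun c => by
    rw [IsScalarTower.algebraMap_apply K K' F']
    exact A.algebraMap_mem _
  -- the key step: `σ^{-k} A = A` with `0 < k < d` is impossible
  have key : ∀ k, 0 < k → k < d →
      A.comapRingEquiv ((σ ^ k : F' ≃ₐ[F] F') : F' ≃+* F') ≠ A := by
    intro k hk0 hkd h
    obtain ⟨c, hcP, hc⟩ := hαc
    -- `v_A(σ^k (α - c)) < 1`
    have h1' : A.valuation (((σ ^ k : F' ≃ₐ[F] F') : F' ≃+* F') (α - algebraMap F F' c)) < 1 := by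
      rw [← valuation_comapRingEquiv_lt_one_iff ((σ ^ k : F' ≃ₐ[F] F') : F' ≃+* F') A, h]
      exact hc
    have h1 : A.valuation ((σ ^ k) (α - algebraMap F F' c)) < 1 := h1'
    rw [map_sub, AlgEquiv.commutes, algEquiv_pow_apply_eq_pow hσα] at h1
    -- hence `v_A(α^(q^k) - α) < 1`
    have h2 : A.valuation (α ^ (q ^ k) - α) < 1 := by
      have : α ^ (q ^ k) - α = (α ^ (q ^ k) - algebraMap F F' c) - (α - algebraMap F F' c) := by
        ring
      rw [this, sub_eq_add_neg]
      exact A.valuation.map_add_lt h1 (by rwa [Valuation.map_neg])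
    -- but `α^(q^k) - α ≠ 0` is algebraic over `K`, so a unit of `O_A`
    have h0 : α ^ (q ^ k) - α ≠ 0 := sub_ne_zero.mpr (hne k hk0 hkd)
    have hint : IsIntegral K (α ^ (q ^ k) - α) := (halg.isIntegral.pow _).sub halg.isIntegral
    have hinv : (α ^ (q ^ k) - α)⁻¹ ∈ A.toValuationSubring :=
      IsAlgFunctionField.mem_valuationSubring_of_isAlgebraic (K := K) A.toValuationSubring hK
        hint.inv.isAlgebraic
    exact (valuation_lt_one_iff_inv_notMem A.toValuationSubring h0).mp h2 hinv
  intro i j hij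
  simp only at hij
  rcases lt_trichotomy (i : ℕ) j with hlt | heq | hgt
  · exfalso
    refine key (j - i) (Nat.sub_pos_of_lt hlt) (lt_of_le_of_lt (Nat.sub_le _ _) j.2) ?_
    apply comapRingEquiv_injective ((σ ^ (i : ℕ) : F' ≃ₐ[F] F') : F' ≃+* F')
    rw [comapRingEquiv_comapRingEquiv, hij]
    congr 1
    ext x
    change (σ ^ (j - i : ℕ)) ((σ ^ (i : ℕ)) x) = (σ ^ (j : ℕ)) x
    rw [← AlgEquiv.mul_apply, ← pow_add, Nat.sub_add_cancel hlt.le]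
  · exact Fin.ext heq
  · exfalso
    refine key (i - j) (Nat.sub_pos_of_lt hgt) (lt_of_le_of_lt (Nat.sub_le _ _) i.2) ?_
    apply comapRingEquiv_injective ((σ ^ (j : ℕ) : F' ≃ₐ[F] F') : F' ≃+* F')
    rw [comapRingEquiv_comapRingEquiv, ← hij]
    congr 1
    ext x
    change (σ ^ (i - j : ℕ)) ((σ ^ (j : ℕ)) x) = (σ ^ (i : ℕ)) x
    rw [← AlgEquiv.mul_apply, ← pow_add, Nat.sub_add_cancel hgt.le]

end Conjugates


/-! ### B5. Residue degree one from `[F' : F]` distinct places above `P`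
(the inequality `∑ f(P'|P) ≤ [F' : F]`, Stichtenoth Thm. 3.1.11, in the form needed here) -/

section ResidueDegree

variable [FiniteDimensional F F']

/-- **Fundamental inequality, totally split form** (Stichtenoth Thm. 3.1.11 `∑ eᵢ fᵢ ≤ [F' : F]`,
special case): if `[F' : F]` pairwise distinct places `P'ᵢ` of `F'` lie over the place `P` of `F`
(`O_{P'ᵢ} ∩ F = O_P`), then every `P'ᵢ` has residue degree one over `P`: each `y ∈ O_{P'ᵢ}` is
congruent modulo `P'ᵢ` to an element of `O_P`. Proof as printed (independence via weak
approximation, Thm. 1.3.1): otherwise weak approximation in `F'` produces `[F' : F] + 1` elements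
of `F'` (one congruent to `1` at `P'ᵢ` and to `0` at the other `P'ⱼ`, for each `i`, and one congruent
to `y` at `P'_{i₀}` and to `0` elsewhere) which are `F`-linearly independent — normalise a relation
by the coefficient of largest `v_P` and reduce it modulo the corresponding place.
[cite: Stichtenoth2009, Thm. 3.1.11] -/
theorem exists_valuation_sub_algebraMap_lt_one {ι : Type*} [Fintype ι] (P : PlaceOver K F)
    (B : ι → PlaceOver K' F') (hB : Function.Injective B)
    (hBP : ∀ i (x : F), algebraMap F F' x ∈ (B i).toValuationSubring ↔ x ∈ P.toValuationSubring)
    (hcard : Module.finrank F F' ≤ Fintype.card ι) (i₀ : ι) {y : F'}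
    (hy : y ∈ (B i₀).toValuationSubring) :
    ∃ x ∈ P.toValuationSubring, (B i₀).valuation (y - algebraMap F F' x) < 1 := by
  by_contra hcon
  push Not at hcon
  -- weak approximation in `F'` at the places `B i`
  have happrox : ∀ a : PlaceOver K' F' → F', ∃ z : F', ∀ i, (B i).valuation (z - a (B i)) < 1 := by
    intro a
    obtain ⟨z, hz⟩ := exists_forall_valuation_sub_le (Finset.univ.image B) a (fun _ => 1)
    refine ⟨z, fun i => ?_⟩
    have := hz (B i) (Finset.mem_image_of_mem B (Finset.mem_univ i))
    rw [zpow_one] at this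
    exact this.trans_lt (B i).valuation_uniformizer_lt_one
  -- targets: `ev k Q` is the prescribed residue of the `k`-th element at the place `Q`
  let ev : Option ι → PlaceOver K' F' → F' := fun k Q =>
    Option.elim k (if Q = B i₀ then y else 0) fun i => if Q = B i then 1 else 0
  choose u hu using fun k => happrox (ev k)
  -- the family `u` is `F`-linearly independent
  have hli : LinearIndependent F u := by
    rw [Fintype.linearIndependent_iff]
    intro g hg
    by_contra hne
    push Not at hne
    obtain ⟨ks, -, hmax⟩ :=
      Finset.exists_max_image Finset.univ (fun k => P.valuation (g k)) Finset.univ_nonempty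
    have hg0 : g ks ≠ 0 := by
      obtain ⟨k, hk⟩ := hne
      intro h0
      have := hmax k (Finset.mem_univ k)
      rw [h0, Valuation.map_zero, le_zero_iff, Valuation.zero_iff] at this
      exact hk this
    -- normalised coefficients `c k = g k / g ks ∈ O_P`, `c ks = 1`
    set c : Option ι → F := fun k => g k / g ks with hc
    have hcP : ∀ k, c k ∈ P.toValuationSubring := fun k => by
      rw [← P.toValuationSubring.valuation_le_one_iff]
      change P.valuation (g k / g ks) ≤ 1
      rw [map_div₀, div_le_one₀ ((Valuation.pos_iff _).mpr hg0)]
      exact hmax k (Finset.mem_univ k)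
    have hcs : c ks = 1 := div_self hg0
    set a : Option ι → F' := fun k => algebraMap F F' (c k) with ha
    have haB : ∀ k j, (B j).valuation (a k) ≤ 1 := fun k j =>
      ((B j).toValuationSubring.valuation_le_one_iff _).mpr ((hBP j (c k)).mpr (hcP k))
    have has : a ks = 1 := by rw [ha]; simp only [hcs, map_one]
    have hrel : ∑ k, a k * u k = 0 := by
      have : ∑ k, a k * u k = algebraMap F F' (g ks)⁻¹ * ∑ k, g k • u k := by
        rw [Finset.mul_sum]
        refine Finset.sum_congr rfl fun k _ => ?_
        rw [ha, hc]
        simp only [Algebra.smul_def, div_eq_inv_mul, map_mul, mul_assoc]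
      rw [this, hg, mul_zero]
    -- reduction modulo `B j`: `v_{B j}(a (some j) + a none · ev none (B j)) < 1` for every `j`
    have hred : ∀ j, (B j).valuation (a (some j) + a none * (if B j = B i₀ then y else 0)) < 1 := by
      intro j
      have hE : ∑ k, a k * ev k (B j) = a (some j) + a none * (if B j = B i₀ then y else 0) := by
        rw [Fintype.sum_option, add_comm]
        congr 1
        simp only [ev, Option.elim]
        have : ∀ i, a (some i) * (if B j = B i then (1 : F') else 0) =
            if j = i then a (some i) else 0 := by
          intro i
          by_cases h : j = i
          · subst h; simp
          · rw [if_neg (fun h' => h (hB h')), if_neg h, mul_zero]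
        simp_rw [this]
        rw [Finset.sum_ite_eq Finset.univ j (fun i => a (some i)), if_pos (Finset.mem_univ j)]
      have hD : (B j).valuation (∑ k, a k * (u k - ev k (B j))) < 1 := by
        refine Valuation.map_sum_lt _ one_ne_zero fun k _ => ?_
        rw [Valuation.map_mul]
        exact (mul_le_of_le_one_left' (haB k j)).trans_lt (hu k j)
      have hsum : ∑ k, a k * (u k - ev k (B j)) = -(a (some j) + a none * (if B j = B i₀ then y else 0)) := by
        rw [← hE, ← sub_eq_zero, sub_neg_eq_add, ← Finset.sum_add_distrib, ← hrel]
        exact Finset.sum_congr rfl fun k _ => by ring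
      rw [hsum, Valuation.map_neg] at hD
      exact hD
    -- case analysis on the index of the dominant coefficient
    rcases hks : ks with _ | i
    · -- `ks = none`: `a none = 1`, contradiction at `B i₀` with `x = -c (some i₀)`
      rw [hks] at has
      have h1 := hred i₀
      rw [if_pos rfl, has, one_mul] at h1
      refine (not_lt.mpr (hcon (-c (some i₀)) (neg_mem (hcP _)))) ?_
      rw [map_neg, sub_neg_eq_add, add_comm]
      exact h1
    · by_cases hi : i = i₀
      · -- `ks = some i₀`: `a (some i₀) = 1`; then `a none` is a unit and `x = -(c none)⁻¹`
        subst hi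
        rw [hks] at has
        have h1 := hred i
        rw [if_pos rfl, has] at h1
        -- `v (a none * y) = 1`
        have h2 : (B i).valuation (a none * y) = 1 := by
          have h3 : (B i).valuation (1 + a none * y) < (B i).valuation (-1) := by
            rw [Valuation.map_neg, Valuation.map_one]; exact h1
          have := Valuation.map_add_eq_of_lt_right _ h3
          rw [add_neg_cancel_comm, Valuation.map_neg, Valuation.map_one] at this
          -- this : v (a none * y) = 1 ... check the algebra
          exact this
        have hyv : (B i).valuation y ≤ 1 := ((B i).toValuationSubring.valuation_le_one_iff y).mpr hy
        have h4 : (B i).valuation (a none) = 1 := by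
          refine le_antisymm (haB none i) ?_
          calc (1 : (B i).toValuationSubring.ValueGroup) = (B i).valuation (a none) * (B i).valuation y := by
                rw [← Valuation.map_mul, h2]
            _ ≤ (B i).valuation (a none) * 1 := by gcongr
            _ = (B i).valuation (a none) := mul_one _
        have hc0 : c none ≠ 0 := by
          intro h0
          rw [ha] at h4
          simp only [h0, map_zero] at h4
          exact zero_ne_one h4
        have hcinv : (c none)⁻¹ ∈ P.toValuationSubring := by
          rw [← hBP i, ← (B i).toValuationSubring.valuation_le_one_iff, map_inv₀]
          change ((B i).valuation (a none))⁻¹ ≤ 1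
          rw [h4, inv_one]
        refine (not_lt.mpr (hcon (-(c none)⁻¹) (neg_mem hcinv))) ?_
        have h5 : y - algebraMap F F' (-(c none)⁻¹) = (a none)⁻¹ * (1 + a none * y) := by
          have ha0 : a none ≠ 0 := by rw [ha]; exact (_root_.map_ne_zero _).mpr hc0
          rw [map_neg, map_inv₀, sub_neg_eq_add, mul_add, mul_one, ← mul_assoc,
            inv_mul_cancel₀ ha0, one_mul, add_comm]
        rw [h5, Valuation.map_mul, map_inv₀, h4, inv_one, one_mul]
        exact h1
      · -- `ks = some i`, `i ≠ i₀`: `v_{B i}(1) < 1`, absurd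
        rw [hks] at has
        have h1 := hred i
        rw [if_neg (fun h => hi (hB h)), mul_zero, add_zero, has, Valuation.map_one] at h1
        exact lt_irrefl _ h1
  have := hli.fintype_card_le_finrank
  rw [Fintype.card_option] at this
  omega

end ResidueDegree


/-! ### B6. The residue map `F_P → F'_{P'}`; degrees of totally split places; residues of constants -/

section ResidueMap

variable (P : PlaceOver K F) (B : PlaceOver K' F')
  (hBP : ∀ x : F, algebraMap F F' x ∈ B.toValuationSubring ↔ x ∈ P.toValuationSubring)

/-- The inclusion `O_P → O_{P'}` for a place `P'` of `F'` with `O_{P'} ∩ F = O_P`. [folklore] -/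
def resHom : P.toValuationSubring →+* B.toValuationSubring where
  toFun x := ⟨algebraMap F F' x, (hBP x).mpr x.2⟩
  map_one' := Subtype.ext (by simp)
  map_mul' x y := Subtype.ext (by simp)
  map_zero' := Subtype.ext (by simp)
  map_add' x y := Subtype.ext (by simp)

/-- Underlying map of `resHom` (definitional). [folklore] -/
theorem coe_resHom (x : P.toValuationSubring) : (resHom P B hBP x : F') = algebraMap F F' x := rfl

/-- `O_P → O_{P'}` is a local homomorphism (`O_{P'}ˣ ∩ F = O_Pˣ`). [folklore] -/
instance isLocalHom_resHom : IsLocalHom (resHom P B hBP) := by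
  refine ⟨fun x hx => ?_⟩
  rw [ValuationSubring.valuation_eq_one_iff] at hx ⊢
  rw [coe_resHom] at hx
  have hx0 : (x : F) ≠ 0 := by
    intro h0
    rw [h0, map_zero, Valuation.map_zero] at hx
    exact zero_ne_one hx
  apply le_antisymm (P.toValuationSubring.valuation_le_one _)
  rw [Valuation.one_le_val_iff _ hx0, P.toValuationSubring.valuation_le_one_iff, ← hBP,
    map_inv₀, ← B.toValuationSubring.valuation_le_one_iff, map_inv₀, hx, inv_one]

/-- The induced embedding of residue fields `F_P → F'_{P'}` is injective. [folklore] -/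
theorem residueField_map_injective :
    Function.Injective (IsLocalRing.ResidueField.map (resHom P B hBP)) :=
  RingHom.injective _

/-- `x ↦ x̄`: the residue of `algebraMap F F' c`, `c ∈ O_P`, is the image of `c̄ ∈ F_P`. [folklore] -/
theorem residue_algebraMap_eq (c : P.toValuationSubring) :
    IsLocalRing.residue B.toValuationSubring ⟨algebraMap F F' c, (hBP c).mpr c.2⟩ =
      IsLocalRing.ResidueField.map (resHom P B hBP) (IsLocalRing.residue _ c) :=
  rfl

/-- Congruence modulo `P'` in terms of the valuation: `ȳ = z̄ ↔ v_{P'}(y - z) < 1`. [folklore] -/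
theorem residue_eq_residue_iff (y z : B.toValuationSubring) :
    IsLocalRing.residue B.toValuationSubring y = IsLocalRing.residue _ z ↔
      B.valuation ((y : F') - z) < 1 := by
  change Ideal.Quotient.mk _ y = Ideal.Quotient.mk _ z ↔ _
  rw [Ideal.Quotient.mk_eq_mk_iff_sub_mem, ValuationSubring.valuation_lt_one_iff]
  rfl

end ResidueMap

section Degree

variable [Algebra K K']
variable [Finite K] [IsAlgFunctionField K F] [Finite K'] [IsAlgFunctionField K' F']

/-- **Degree of a totally split place** (Stichtenoth Lemma 5.1.9 (d), `deg P' = deg P / [K' : K]`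
when `f(P'|P) = 1`): if `O_{P'} ∩ F = O_P` and every residue class of `P'` has a representative in
`O_P`, then `F_P ≅ F'_{P'}` and `deg P' · [K' : K] = deg P` (comparing `#F_P = q^{deg P}` with
`#F'_{P'} = (q^{[K':K]})^{deg P'}`). [cite: Stichtenoth2009, Lemma 5.1.9(d)] -/
theorem degree_mul_finrank_eq_degree [Module.Finite K K'] (P : PlaceOver K F) (B : PlaceOver K' F')
    (hBP : ∀ x : F, algebraMap F F' x ∈ B.toValuationSubring ↔ x ∈ P.toValuationSubring)
    (hres : ∀ y ∈ B.toValuationSubring, ∃ x ∈ P.toValuationSubring,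
      B.valuation (y - algebraMap F F' x) < 1) :
    B.degree * Module.finrank K K' = P.degree := by
  set ρ := IsLocalRing.ResidueField.map (resHom P B hBP) with hρ
  have hρ_bij : Function.Bijective ρ := by
    refine ⟨residueField_map_injective P B hBP, fun t => ?_⟩
    obtain ⟨y, rfl⟩ := Ideal.Quotient.mk_surjective t
    obtain ⟨x, hxP, hxy⟩ := hres y y.2
    refine ⟨IsLocalRing.residue _ ⟨x, hxP⟩, ?_⟩
    change ρ (IsLocalRing.residue _ ⟨x, hxP⟩) = IsLocalRing.residue _ y
    rw [hρ, ← residue_algebraMap_eq P B hBP ⟨x, hxP⟩, residue_eq_residue_iff,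
      Valuation.map_sub_swap]
    exact hxy
  have h1 : Nat.card P.residueField = Nat.card B.residueField :=
    Nat.card_eq_of_bijective ρ hρ_bij
  rw [natCard_residueField P, natCard_residueField B,
    Module.natCard_eq_pow_finrank (K := K) (V := K'), ← pow_mul] at h1
  have h2 := Nat.pow_right_injective (Finite.one_lt_card (α := K)) h1
  rw [h2, mul_comm]

omit [Algebra K K'] [IsAlgFunctionField K' F'] in
/-- **Residues of constants** (the fact behind `F'_{P'} = F_P · 𝔽_{q^r}`, Stichtenoth Thm. 3.6.3 (g)
/ Lemma 5.1.9 (d)): if `#K' = q^d` and `d ∣ deg P`, then for every constant `r ∈ K'` the residue of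
`r` at a place `P'` over `P` already lies in `F_P`, i.e. `v_{P'}(r - c) < 1` for some `c ∈ O_P`.
Proof: `r^{q^{deg P}} = r`, the image of `F_P` in `F'_{P'}` consists of `q^{deg P}` roots of
`X^{q^{deg P}} - X`, and a polynomial has no more roots than its degree.
[cite: Stichtenoth2009, Lemma 5.1.9(d)] -/
theorem exists_valuation_algebraMap_sub_lt_one (P : PlaceOver K F) (A : PlaceOver K' F')
    (hAP : ∀ x : F, algebraMap F F' x ∈ A.toValuationSubring ↔ x ∈ P.toValuationSubring)
    {d : ℕ} (hcard : Nat.card K' = Nat.card K ^ d) (hdvd : d ∣ P.degree) (r : K') :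
    ∃ c ∈ P.toValuationSubring, A.valuation (algebraMap K' F' r - algebraMap F F' c) < 1 := by
  haveI := Fintype.ofFinite K'
  set q := Nat.card K with hq
  set m := P.degree with hm
  have hq1 : 1 < q := Finite.one_lt_card
  have hm1 : 1 ≤ m := P.one_le_degree
  have hqm : 1 < q ^ m := Nat.one_lt_pow (by omega) hq1
  -- `α := r ∈ O_{P'}` and `α^(q^m) = α`
  have hαA : algebraMap K' F' r ∈ A.toValuationSubring := A.algebraMap_mem r
  obtain ⟨e, he⟩ := hdvd
  have hrpow : r ^ (q ^ m) = r := by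
    rw [he, pow_mul, ← hcard, Nat.card_eq_fintype_card, FiniteField.pow_card_pow]
  set αA : A.toValuationSubring := ⟨algebraMap K' F' r, hαA⟩ with hαAdef
  have hαpow : αA ^ (q ^ m) = αA := Subtype.ext (by
    rw [hαAdef, SubmonoidClass.coe_pow, ← map_pow, hrpow])
  -- the residue fields
  haveI : Finite P.residueField := P.finite_residueField
  letI : Fintype P.residueField := Fintype.ofFinite _
  have hcardP : Fintype.card P.residueField = q ^ m := by
    rw [Fintype.card_eq_nat_card, natCard_residueField P]
  set ρ := IsLocalRing.ResidueField.map (resHom P A hAP) with hρ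
  set a := IsLocalRing.residue A.toValuationSubring αA with ha
  -- `ā` is one of the `q^m` roots of `X^(q^m) - X` coming from `F_P`
  have hmem : a ∈ Finset.univ.image ρ := by
    by_contra hnot
    set f : Polynomial A.residueField := X ^ (q ^ m) - X with hf
    have hf0 : f ≠ 0 := FiniteField.X_pow_card_sub_X_ne_zero A.residueField hqm
    have hroot : ∀ t : A.residueField, t ^ (q ^ m) = t → t ∈ f.roots := fun t ht => by
      rw [mem_roots hf0, IsRoot.def, hf, eval_sub, eval_pow, eval_X, ht, sub_self]
    have hsub : (insert a (Finset.univ.image ρ)).val ⊆ f.roots := by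
      intro t ht
      rw [Finset.mem_val, Finset.mem_insert, Finset.mem_image] at ht
      rcases ht with rfl | ⟨b, -, rfl⟩
      · apply hroot
        rw [ha, ← map_pow, hαpow]
      · apply hroot
        rw [← map_pow, ← hcardP, FiniteField.pow_card]
    have hle := card_le_degree_of_subset_roots hsub
    rw [Finset.card_insert_of_notMem hnot,
      Finset.card_image_of_injective _ (residueField_map_injective P A hAP), Finset.card_univ,
      hcardP, hf, FiniteField.X_pow_card_sub_X_natDegree_eq A.residueField hqm] at hle
    omega
  rw [Finset.mem_image] at hmem
  obtain ⟨b, -, hb⟩ := hmem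
  obtain ⟨c, rfl⟩ := Ideal.Quotient.mk_surjective b
  refine ⟨c, c.2, ?_⟩
  have h1 : IsLocalRing.residue A.toValuationSubring αA =
      IsLocalRing.residue _ ⟨algebraMap F F' c, (hAP c).mpr c.2⟩ := by
    rw [residue_algebraMap_eq P A hAP c, ← ha, ← hb]
    rfl
  rwa [residue_eq_residue_iff] at h1

end Degree
end PlaceOver

end Extension


/-! ## B7. The `∂` conjugate places of `F' = F·𝔽_{q^∂}` above a place of `F` -/

section Assembly

variable {K : Type u} {F : Type v} [Field K] [Field F] [Algebra K F]
variable [Fintype K] [IsAlgFunctionField K F] [IsIntegrallyClosedIn K F]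
variable (φ : K[X]) [hirr : Fact (Irreducible φ)]

/-- A chosen place of `F'` above the place `P` of `F` (Stichtenoth Prop. 3.1.7 (b)).
[cite: Stichtenoth2009, Prop. 3.1.7(b)] -/
def placeAbove (P : PlaceOver K F) :
    PlaceOver (AdjoinRoot φ) (AdjoinRoot (φ.map (algebraMap K F))) :=
  Classical.choose (PlaceOver.exists_restrict_eq (K := K) (F := F) (K' := AdjoinRoot φ)
    (F' := AdjoinRoot (φ.map (algebraMap K F))) P)

/-- The chosen place lies above `P`. [cite: Stichtenoth2009, Prop. 3.1.7(b)] -/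
theorem restrict_placeAbove (P : PlaceOver K F) :
    (placeAbove φ P).restrict (K := K) (F := F) = P :=
  Classical.choose_spec (PlaceOver.exists_restrict_eq (K := K) (F := F) (K' := AdjoinRoot φ)
    (F' := AdjoinRoot (φ.map (algebraMap K F))) P)

/-- The `i`-th Frobenius conjugate `σ^{-i} P'` of the chosen place `P'` above `P`
(Stichtenoth Lemma 5.1.9 (d): the places `P₁, …, P_d` above `P`). [cite: Stichtenoth2009, Lemma 5.1.9(d)] -/
def conjPlace (i : ℕ) (P : PlaceOver K F) :
    PlaceOver (AdjoinRoot φ) (AdjoinRoot (φ.map (algebraMap K F))) :=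
  (placeAbove φ P).comapRingEquiv
    ((frob φ ^ i : AdjoinRoot (φ.map (algebraMap K F)) ≃ₐ[F] AdjoinRoot (φ.map (algebraMap K F))) :
      AdjoinRoot (φ.map (algebraMap K F)) ≃+* AdjoinRoot (φ.map (algebraMap K F)))

/-- Every conjugate place lies above `P` (automorphisms over `F` fix the place below,
Stichtenoth Lemma 3.5.2). [cite: Stichtenoth2009, Lemma 3.5.2] -/
theorem restrict_conjPlace (i : ℕ) (P : PlaceOver K F) :
    (conjPlace φ i P).restrict (K := K) (F := F) = P := by
  rw [conjPlace, PlaceOver.restrict_comapRingEquiv, restrict_placeAbove]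

/-- `σ^{-i} P'` lies over `P`: `O ∩ F = O_P`. [folklore] -/
theorem algebraMap_mem_conjPlace_iff (i : ℕ) (P : PlaceOver K F) (x : F) :
    algebraMap F (AdjoinRoot (φ.map (algebraMap K F))) x ∈ (conjPlace φ i P).toValuationSubring ↔
      x ∈ P.toValuationSubring := by
  rw [← PlaceOver.mem_restrict_iff (K := K) (F := F), restrict_conjPlace]

/-- The conjugate places over different base places differ. [folklore] -/
theorem conjPlace_injective_right (i : ℕ) :
    Function.Injective (conjPlace φ i : PlaceOver K F → _) :=
  fun P Q h => by rw [← restrict_conjPlace φ i P, ← restrict_conjPlace φ i Q, h]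

/-- **Stichtenoth Lemma 5.1.9 (d), distinctness**: if `deg φ ∣ deg P`, the `deg φ` conjugate
places `σ^{-i} P'`, `i < deg φ`, above `P` are pairwise distinct. [cite: Stichtenoth2009, Lemma 5.1.9(d)] -/
theorem conjPlace_injective_left (P : PlaceOver K F) (hdvd : φ.natDegree ∣ P.degree) :
    Function.Injective fun i : Fin φ.natDegree => conjPlace φ i P := by
  have hαc : ∃ c ∈ P.toValuationSubring, (placeAbove φ P).valuation
      (AdjoinRoot.root (φ.map (algebraMap K F)) -
        algebraMap F (AdjoinRoot (φ.map (algebraMap K F))) c) < 1 := by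
    have := PlaceOver.exists_valuation_algebraMap_sub_lt_one (K := K) (F := F) P (placeAbove φ P)
      (fun x => by rw [← PlaceOver.mem_restrict_iff (K := K) (F := F), restrict_placeAbove])
      (natCard_adjoinRoot φ) hdvd (AdjoinRoot.root φ)
    rwa [algebraMap_root] at this
  exact PlaceOver.comapRingEquiv_pow_injective P (placeAbove φ P) (frob φ) (frob_root φ)
    (fun k hk0 hk => root_map_pow_ne φ hk0 hk) (isIntegral_root_map φ).isAlgebraic hαc

/-- **Stichtenoth Lemma 5.1.9 (d), degrees**: if `deg φ ∣ deg P`, each conjugate place above `P`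
has residue degree one over `P`, hence `deg (σ^{-i} P') · deg φ = deg P` (degree over
`K' = 𝔽_{q^{deg φ}}`). [cite: Stichtenoth2009, Lemma 5.1.9(d)] -/
theorem degree_conjPlace_mul (P : PlaceOver K F) (hdvd : φ.natDegree ∣ P.degree) {i : ℕ}
    (hi : i < φ.natDegree) : (conjPlace φ i P).degree * φ.natDegree = P.degree := by
  rw [← finrank_adjoinRoot φ]
  refine PlaceOver.degree_mul_finrank_eq_degree P _ (algebraMap_mem_conjPlace_iff φ i P) ?_
  intro y hy
  exact PlaceOver.exists_valuation_sub_algebraMap_lt_one P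
    (fun j : Fin φ.natDegree => conjPlace φ j P) (conjPlace_injective_left φ P hdvd)
    (fun j x => algebraMap_mem_conjPlace_iff φ j P x)
    (by rw [finrank_adjoinRoot_map, Fintype.card_fin]) ⟨i, hi⟩ hy

end Assembly


/-! ## C. Counting positive divisors: `F' = F·𝔽_{q^∂}` has too many of them if `∂ ≥ 2` -/

section Counting

variable {K : Type u} {F : Type v} [Field K] [Field F] [Algebra K F]
variable [Fintype K] [IsAlgFunctionField K F] [IsIntegrallyClosedIn K F]
variable (φ : K[X]) [hirr : Fact (Irreducible φ)]

/-- Push-forward of a divisor of `F` to `F'` along the `i`-th conjugate section `P ↦ σ^{-i} P'`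
(a piece of the conorm `Con_{F'/F}`, Stichtenoth Def. 3.1.8). [cite: Stichtenoth2009, Def. 3.1.8] -/
def pushDiv (i : ℕ) (D : Divisor K F) : Divisor (AdjoinRoot φ) (AdjoinRoot (φ.map (algebraMap K F))) :=
  Finsupp.mapDomain (conjPlace φ i) D

/-- The push-forward has the coefficient `D(P)` at the conjugate place above `P`. [folklore] -/
theorem pushDiv_apply_conjPlace (i : ℕ) (D : Divisor K F) (P : PlaceOver K F) :
    pushDiv φ i D (conjPlace φ i P) = D P :=
  Finsupp.mapDomain_apply (conjPlace_injective_right φ i) D P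

/-- If every place degree is a multiple of `deg φ`, different conjugate sections have disjoint
images. [cite: Stichtenoth2009, Lemma 5.1.9(d)] -/
theorem pushDiv_apply_conjPlace_of_ne (hall : ∀ P : PlaceOver K F, φ.natDegree ∣ P.degree)
    {i j : ℕ} (hi : i < φ.natDegree) (hj : j < φ.natDegree) (hij : i ≠ j) (D : Divisor K F)
    (P : PlaceOver K F) : pushDiv φ j D (conjPlace φ i P) = 0 := by
  apply Finsupp.mapDomain_notin_range
  rintro ⟨Q, hQ⟩
  have hPQ : Q = P := by rw [← restrict_conjPlace φ j Q, hQ, restrict_conjPlace]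
  subst hPQ
  have := conjPlace_injective_left φ Q (hall Q) (a₁ := ⟨j, hj⟩) (a₂ := ⟨i, hi⟩) hQ
  exact hij (Fin.mk.inj_iff.mp this).symm

/-- Push-forwards of positive divisors are positive. [folklore] -/
theorem pushDiv_nonneg (i : ℕ) {D : Divisor K F} (hD : 0 ≤ D) : 0 ≤ pushDiv φ i D := by
  refine Finsupp.le_def.mpr fun Q => ?_
  rw [Finsupp.coe_zero, Pi.zero_apply]
  by_cases hQ : Q ∈ Set.range (conjPlace φ i)
  · obtain ⟨P, rfl⟩ := hQ
    rw [pushDiv_apply_conjPlace]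
    simpa using hD P
  · rw [pushDiv, Finsupp.mapDomain_notin_range _ _ hQ]

/-- `deg' (push D) · deg φ = deg D`: the conjugate places above `P` have degree `deg P / deg φ`
over `K'`. [cite: Stichtenoth2009, Lemma 5.1.9(d)] -/
theorem degree_pushDiv_mul (hall : ∀ P : PlaceOver K F, φ.natDegree ∣ P.degree) {i : ℕ}
    (hi : i < φ.natDegree) (D : Divisor K F) :
    (pushDiv φ i D).degree * φ.natDegree = D.degree := by
  rw [Divisor.degree_apply, Divisor.degree_apply, pushDiv,
    Finsupp.sum_mapDomain_index_inj (conjPlace_injective_right φ i), Finsupp.sum_mul]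
  refine Finset.sum_congr rfl fun P _ => ?_
  dsimp only
  rw [mul_assoc, ← Nat.cast_mul, degree_conjPlace_mul φ P (hall P) hi]

/-- A pair of divisors of `F` is recovered from the sum of its two push-forwards along the
sections `0` and `1`. [folklore] -/
theorem pushDiv_add_pushDiv_injective (hall : ∀ P : PlaceOver K F, φ.natDegree ∣ P.degree)
    (hd : 2 ≤ φ.natDegree) {D₁ D₂ D₁' D₂' : Divisor K F}
    (h : pushDiv φ 0 D₁ + pushDiv φ 1 D₂ = pushDiv φ 0 D₁' + pushDiv φ 1 D₂') :
    D₁ = D₁' ∧ D₂ = D₂' := by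
  have h0 : (0 : ℕ) < φ.natDegree := by omega
  have h1 : (1 : ℕ) < φ.natDegree := by omega
  constructor
  · ext P
    have := congrArg (fun E => E (conjPlace φ 0 P)) h
    simpa only [Finsupp.add_apply, pushDiv_apply_conjPlace,
      pushDiv_apply_conjPlace_of_ne φ hall h0 h1 zero_ne_one, add_zero] using this
  · ext P
    have := congrArg (fun E => E (conjPlace φ 1 P)) h
    simpa only [Finsupp.add_apply, pushDiv_apply_conjPlace,
      pushDiv_apply_conjPlace_of_ne φ hall h1 h0 one_ne_zero, zero_add] using this

/-- **Too many positive divisors upstairs.** With `d = deg φ`, `j₀ ≤ n / 2`: the positive divisors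
`push₀ D₁ + push₁ D₂` of `F'` of degree `n`, `deg D₁ = (j₀ + j) d`, `deg D₂ = (n - j₀ - j) d`,
`0 ≤ j ≤ n - 2 j₀`, are pairwise distinct, so
`∑ⱼ A_{(j₀+j)d} A_{(n-j₀-j)d} ≤ A'_n`. [folklore] -/
theorem sum_numPosDivisors_mul_le (hall : ∀ P : PlaceOver K F, φ.natDegree ∣ P.degree)
    (hd : 2 ≤ φ.natDegree) (n j₀ : ℕ) (hn : 2 * j₀ ≤ n) :
    ∑ j ∈ Finset.range (n - 2 * j₀ + 1),
        numPosDivisors K F ((j₀ + j) * φ.natDegree) *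
          numPosDivisors K F ((n - j₀ - j) * φ.natDegree) ≤
      numPosDivisors (AdjoinRoot φ) (AdjoinRoot (φ.map (algebraMap K F))) n := by
  classical
  set d := φ.natDegree with hd_def
  have h0 : 0 < d := by omega
  have h1 : 1 < d := by omega
  -- the finite sets of positive divisors
  set T : ℕ → Finset (Divisor K F) := fun k =>
    (finite_setOf_nonneg_degree_eq (K := K) (F := F) (k : ℤ)).toFinset with hT
  have hTmem : ∀ k D, D ∈ T k ↔ 0 ≤ D ∧ D.degree = k := fun k D => by
    rw [hT, Set.Finite.mem_toFinset, Set.mem_setOf_eq]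
  have hTcard : ∀ k, (T k).card = numPosDivisors K F k := fun k => by
    rw [numPosDivisors, hT, ← Nat.card_eq_card_finite_toFinset]
    rfl
  set E : Finset (Divisor (AdjoinRoot φ) (AdjoinRoot (φ.map (algebraMap K F)))) :=
    (finite_setOf_nonneg_degree_eq (K := AdjoinRoot φ) (F := AdjoinRoot (φ.map (algebraMap K F)))
      (n : ℤ)).toFinset with hE
  have hEmem : ∀ D, D ∈ E ↔ 0 ≤ D ∧ D.degree = n := fun D => by
    rw [hE, Set.Finite.mem_toFinset, Set.mem_setOf_eq]
  have hEcard :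
      E.card = numPosDivisors (AdjoinRoot φ) (AdjoinRoot (φ.map (algebraMap K F))) n := by
    rw [numPosDivisors, hE, ← Nat.card_eq_card_finite_toFinset]
    rfl
  -- the images `S j`
  set Φ : Divisor K F × Divisor K F → Divisor (AdjoinRoot φ) (AdjoinRoot (φ.map (algebraMap K F))) :=
    fun p => pushDiv φ 0 p.1 + pushDiv φ 1 p.2 with hΦ
  have hΦinj : Function.Injective Φ := fun p p' hpp' => by
    obtain ⟨h₁, h₂⟩ := pushDiv_add_pushDiv_injective φ hall hd hpp'
    exact Prod.ext h₁ h₂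
  set S : ℕ → Finset (Divisor (AdjoinRoot φ) (AdjoinRoot (φ.map (algebraMap K F)))) := fun j =>
    ((T ((j₀ + j) * d)) ×ˢ (T ((n - j₀ - j) * d))).image Φ with hS
  have hScard : ∀ j, (S j).card =
      numPosDivisors K F ((j₀ + j) * d) * numPosDivisors K F ((n - j₀ - j) * d) := fun j => by
    rw [hS, Finset.card_image_of_injective _ hΦinj, Finset.card_product, hTcard, hTcard]
  -- `S j ⊆ E` for `j ≤ n - 2 j₀`
  have hSE : ∀ j ∈ Finset.range (n - 2 * j₀ + 1), S j ⊆ E := by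
    intro j hj D hD
    rw [Finset.mem_range] at hj
    rw [hS, Finset.mem_image] at hD
    obtain ⟨⟨D₁, D₂⟩, hD12, rfl⟩ := hD
    rw [Finset.mem_product, hTmem, hTmem] at hD12
    obtain ⟨⟨hD₁, hD₁deg⟩, hD₂, hD₂deg⟩ := hD12
    rw [hEmem]
    refine ⟨add_nonneg (pushDiv_nonneg φ 0 hD₁) (pushDiv_nonneg φ 1 hD₂), ?_⟩
    have hsum : ((pushDiv φ 0 D₁ + pushDiv φ 1 D₂).degree) * (d : ℤ) = n * d := by
      rw [map_add, add_mul, degree_pushDiv_mul φ hall h0, degree_pushDiv_mul φ hall h1, hD₁deg,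
        hD₂deg]
      push_cast
      rw [← add_mul]
      congr 1
      have : j₀ + j + (n - j₀ - j) = n := by omega
      exact_mod_cast this
    exact mul_right_cancel₀ (by exact_mod_cast h0.ne') hsum
  -- the `S j` are pairwise disjoint
  have hdisj : ((Finset.range (n - 2 * j₀ + 1) : Finset ℕ) : Set ℕ).PairwiseDisjoint S := by
    intro j _ j' _ hjj'
    rw [Function.onFun, Finset.disjoint_left]
    intro D hD hD'
    rw [hS, Finset.mem_image] at hD hD'
    obtain ⟨⟨D₁, D₂⟩, hD12, rfl⟩ := hD
    obtain ⟨⟨D₁', D₂'⟩, hD12', hΦeq⟩ := hD'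
    obtain ⟨h₁, -⟩ := pushDiv_add_pushDiv_injective φ hall hd hΦeq
    rw [Finset.mem_product, hTmem, hTmem] at hD12 hD12'
    have := hD12'.1.2
    rw [h₁, hD12.1.2] at this
    have h' : (j₀ + j') * d = (j₀ + j) * d := by exact_mod_cast this.symm
    exact hjj' (by have := Nat.eq_of_mul_eq_mul_right h0 h'; omega)
  calc ∑ j ∈ Finset.range (n - 2 * j₀ + 1),
        numPosDivisors K F ((j₀ + j) * d) * numPosDivisors K F ((n - j₀ - j) * d)
      = ∑ j ∈ Finset.range (n - 2 * j₀ + 1), (S j).card := Finset.sum_congr rfl fun j _ =>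
          (hScard j).symm
    _ = ((Finset.range (n - 2 * j₀ + 1)).biUnion S).card := (Finset.card_biUnion hdisj).symm
    _ ≤ E.card := Finset.card_le_card (Finset.biUnion_subset.mpr hSE)
    _ = numPosDivisors (AdjoinRoot φ) (AdjoinRoot (φ.map (algebraMap K F))) n := hEcard

/-- Lower bound `A_k ≥ q^{k-g}` for `∂ ∣ k`, `k ≥ 2g` (from Lemma 5.1.4 (c): `A_k (q-1) =
h (q^{k+1-g} - 1)` and `h ≥ 1`). [cite: Stichtenoth2009, Lemma 5.1.4(c)] -/
theorem pow_le_numPosDivisors {k : ℕ} (hdvd : minPosDegree K F ∣ k) (hk : 2 * genus K F ≤ k) :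
    Nat.card K ^ (k - genus K F) ≤ numPosDivisors K F k := by
  set q := Nat.card K with hq
  set g := genus K F with hg
  have hq1 : 1 < q := Finite.one_lt_card
  have hmul := numPosDivisors_mul_eq (K := K) (F := F) (n := k) (by omega) hdvd
  set Q := q ^ (k - g) with hQ
  have hQ1 : 1 ≤ Q := Nat.one_le_pow _ _ (by omega)
  have hpow : q ^ (k + 1 - g) = Q * q := by
    rw [hQ, ← pow_succ, show k + 1 - g = k - g + 1 by omega]
  rw [hpow] at hmul
  have h1 : Q * (q - 1) ≤ Q * q - 1 := by
    rw [Nat.mul_sub_one]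
    exact Nat.sub_le_sub_left hQ1 _
  have h2 : Q * q - 1 ≤ classNumber K F * (Q * q - 1) :=
    Nat.le_mul_of_pos_left _ classNumber_pos
  exact Nat.le_of_mul_le_mul_right (h1.trans (h2.trans hmul.symm.le)) (by omega)

omit [Fintype K] [IsIntegrallyClosedIn K F] hirr in
/-- Upper bound `A_n ≤ h q^{n+1}` for a function field over a finite full constant field: the
tree's `numPosDivisors_le_classNumber_mul_pow` (`A_n ≤ h q^{ℓ(0)+n}`, Lemma 5.1.4 with Lemma 1.4.8,
`FunctionFieldSchmidtDegreeOneExtensionProofs`) with `ℓ(0) = 1` (Lemma 1.4.7 (a), `ell_zero_eq_one`).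
[cite: Stichtenoth2009, Lemma 5.1.4] -/
theorem numPosDivisors_le {k : Type u} {L : Type v} [Field k] [Field L] [Algebra k L] [Finite k]
    [IsAlgFunctionField k L] [IsIntegrallyClosedIn k L] (n : ℕ) :
    numPosDivisors k L n ≤ classNumber k L * Nat.card k ^ (n + 1) := by
  have := numPosDivisors_le_classNumber_mul_pow (K := k) (F := L) n
  rwa [ell_zero_eq_one, add_comm] at this

/-- **F. K. Schmidt's theorem `∂ = 1`, a second (zeta-free) proof** (Stichtenoth Cor. 5.1.11; the
tree's discharge is `minPosDegree_eq_one_holds` of `FunctionFieldSchmidtDegreeOneProofs`): if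
`∂ = deg φ ≥ 2` then the constant field extension `F' = F[X]/(φ) = F·𝔽_{q^∂}` would have, for
large `n`, at least `(n - 2g + 1) q^{n∂ - 2g}` positive divisors of degree `n` (pairs of positive
divisors of `F`, pushed forward along two of the `∂` conjugate sections — every place of `F`
splits into `∂` places of `F'` of degree `deg P / ∂`), but it has at most `h' (q^∂)^{n+1}` of them
(Lemma 5.1.4 for `F'/𝔽_{q^∂}`, which is a function field with full constant field `𝔽_{q^∂}`,
Prop. 3.6.1); absurd. This replaces the printed comparison of the pole orders of
`Z_{F'}(t^∂) = Z_F(t)^∂` at `t = 1` (Prop. 5.1.10). [cite: Stichtenoth2009, Cor. 5.1.11] -/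
theorem false_of_two_le_minPosDegree (hmin : minPosDegree K F = φ.natDegree)
    (hd : 2 ≤ φ.natDegree) : False := by
  classical
  set d := φ.natDegree with hd_def
  have h0 : 0 < d := by omega
  -- every place degree is a multiple of `d = ∂`
  have hall : ∀ P : PlaceOver K F, d ∣ P.degree := fun P => by
    have := minPosDegree_dvd_degree (K := K) (F := F) (Finsupp.single P 1)
    rw [Divisor.degree_single, one_mul, hmin] at this
    exact_mod_cast this
  set q := Nat.card K with hq
  set g := genus K F with hg
  set g' := genus (AdjoinRoot φ) (AdjoinRoot (φ.map (algebraMap K F))) with hg'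
  set h' := classNumber (AdjoinRoot φ) (AdjoinRoot (φ.map (algebraMap K F))) with hh'
  have hq1 : 1 < q := Finite.one_lt_card
  have hq' : Nat.card (AdjoinRoot φ) = q ^ d := natCard_adjoinRoot φ
  -- the parameters
  set M := h' * q ^ (d + 2 * g) with hM
  set n := M + 2 * g + 2 * g' with hn
  set N := n * d with hN
  have hNg : 2 * g ≤ N := by
    have : n ≤ n * d := Nat.le_mul_of_pos_right _ h0
    omega
  -- lower bound for each term of the sum
  have hterm : ∀ j ∈ Finset.range (n - 2 * g + 1),
      q ^ (N - 2 * g) ≤ numPosDivisors K F ((g + j) * d) * numPosDivisors K F ((n - g - j) * d) := by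
    intro j hj
    rw [Finset.mem_range] at hj
    set k₁ := (g + j) * d with hk₁
    set k₂ := (n - g - j) * d with hk₂
    have hk₁g : 2 * g ≤ k₁ := by
      have : g * 2 ≤ (g + j) * d := Nat.mul_le_mul (Nat.le_add_right _ _) hd
      omega
    have hk₂g : 2 * g ≤ k₂ := by
      have : g * 2 ≤ (n - g - j) * d := Nat.mul_le_mul (by omega) hd
      omega
    have hk₁₂ : k₁ + k₂ = N := by
      rw [hk₁, hk₂, hN, ← add_mul]
      congr 1
      omega
    have hd₁ : minPosDegree K F ∣ k₁ := hmin ▸ Dvd.intro_left _ rfl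
    have hd₂ : minPosDegree K F ∣ k₂ := hmin ▸ Dvd.intro_left _ rfl
    calc q ^ (N - 2 * g) = q ^ (k₁ - g) * q ^ (k₂ - g) := by
          rw [← pow_add]
          congr 1
          omega
      _ ≤ numPosDivisors K F k₁ * numPosDivisors K F k₂ :=
          Nat.mul_le_mul (pow_le_numPosDivisors hd₁ hk₁g) (pow_le_numPosDivisors hd₂ hk₂g)
  have hlow : (n - 2 * g + 1) * q ^ (N - 2 * g) ≤
      numPosDivisors (AdjoinRoot φ) (AdjoinRoot (φ.map (algebraMap K F))) n := by
    calc (n - 2 * g + 1) * q ^ (N - 2 * g)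
        = ∑ j ∈ Finset.range (n - 2 * g + 1), q ^ (N - 2 * g) := by
          rw [Finset.sum_const, Finset.card_range, smul_eq_mul]
      _ ≤ ∑ j ∈ Finset.range (n - 2 * g + 1),
            numPosDivisors K F ((g + j) * d) * numPosDivisors K F ((n - g - j) * d) :=
          Finset.sum_le_sum hterm
      _ ≤ numPosDivisors (AdjoinRoot φ) (AdjoinRoot (φ.map (algebraMap K F))) n :=
          sum_numPosDivisors_mul_le φ hall hd n g (by omega)
  have hup : numPosDivisors (AdjoinRoot φ) (AdjoinRoot (φ.map (algebraMap K F))) n ≤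
      h' * q ^ (d * (n + 1)) := by
    have := numPosDivisors_le (k := AdjoinRoot φ) (L := AdjoinRoot (φ.map (algebraMap K F))) n
    rwa [hq', ← pow_mul] at this
  have hexp : q ^ (d * (n + 1)) = q ^ (N - 2 * g) * q ^ (d + 2 * g) := by
    rw [← pow_add]
    congr 1
    rw [hN] at hNg ⊢
    have : d * (n + 1) = n * d + d := by ring
    omega
  rw [hexp, ← mul_assoc, mul_comm h', mul_assoc, ← hM] at hup
  have hfin : n - 2 * g + 1 ≤ M :=
    Nat.le_of_mul_le_mul_right (hlow.trans hup |>.trans_eq (mul_comm _ _))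
      (pow_pos (by omega) _)
  omega

end Counting


end Literature.NumberTheory.DiophantineGeometry.AlgFunctionField

end
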